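import Summits.QuantumFields.YangMills.Theorems.SwapTwistDeficitPeriodicRingFloorLog
import Summits.QuantumFields.YangMills.Theorems.SwapTwistDeficitToronLog
import HarnessLib

/-!
# THE LOGARITHMIC PERIODIC FLOOR OF THE ZERO-FLUX RING AT EVERY FIXED `L` (unconditional):
# `c_L·u^{9L⁴−3/2}·log u⁻¹ ≤ μ_L{F₀ ≤ u}`, `c_L·β^{−(9L⁴−3/2)}·log β ≤ ∫e^{−βF₀}dμ_L`, `c_L·e^{12βL⁴}·β^{−(9L⁴−3/2)}·log β ≤ TT.physTrace L β (2L)`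
# (free-hands support of item stmt-QuantumFields-24497 `ToronValleyVolume.ToronTubeVolumeLaw` — its one-sided fixed-`L` half WITH the logarithm of the real
# log-canonical threshold `9L⁴ − 3/2` (multiplicity `2`); brick (A1-iv): the ring assembly ✓`log_physTrace_floor_of_fourLetterVolume` (this seat) instantiated with the
# four-letter volume theorem ✓`ToronLog.haar_pi_nearlyCommuting_ge` (seat w2 g54))

The two halves, landed independently, are joined BY NAME: ✓`SwapTwistDeficit.ToronLog.haar_pi_nearlyCommuting_ge` (`∃ c > 0, ∃ t₀ > 0`,
`c·t⁶·log t⁻¹ ≤ Haar⁴{C : Fin 4 → SU(2) | ∀ μ ν, ‖q(C_μ)q(C_ν) − q(C_ν)q(C_μ)‖ ≤ t}` on `(0, t₀]`) is exactly the hypothesis of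
✓`log_volume_floor_of_fourLetterVolume` ∕ ✓`log_laplace_floor_of_fourLetterVolume` ∕ ✓`log_physTrace_floor_of_fourLetterVolume`.

* ★★★ `log_volume_floor` — `∃ c_L > 0, ∃ u₀ > 0, ∀ u ∈ (0, u₀], c_L·u^{9L⁴−3/2}·log u⁻¹ ≤ (ringMeasure L).real {F₀ ≤ u}`;
* ★★★ `log_laplace_floor` — `∃ c_L > 0, ∃ β₀, ∀ β ≥ β₀, c_L·β^{−(9L⁴−3/2)}·log β ≤ ∫ e^{−βF₀} dμ_L`;
* ★★★ `log_physTrace_floor` — `∃ c_L > 0, ∃ β₀, ∀ β ≥ β₀, c_L·e^{12βL⁴}·β^{−(9L⁴−3/2)}·log β ≤ TT.physTrace L β (2L)`.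

Against ✓`sharp_physTrace_floor` (exponent `9L⁴ − 3/2`, no logarithm) this is the extra `log β` of the commuting-holonomy cone at the central torons —
the prediction `Z ≍ e^{12βL⁴}β^{−(9L⁴−3/2)}·log β` of the fixed-`L` stratum census (seat w2 g54's memo SWAP-STRATA), now a one-sided theorem.
HONEST FRAMING: the cheap direction (a floor) of a fixed-`L` Laplace asymptotic with `exp(−O(L⁴ log L))`-class constants; the CEILING of the same order,
⟨24497⟩ (two-sided, `poly(L)`-uniform), ⟨24196⟩ and every crux ∕ rung ∕ summit stay OPEN; the Yang–Mills mass gap is NOT proved; no summit is proved by a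
line.  THEOREMS ONLY (0 `def`, 0 `sorry`), standard axioms.  Width seat ym-line-sfw-p2-w3 g61 (cell ym-idea-1, free hands), `--supports stmt-QuantumFields-24497`.
References: [cite: Luscher1983, §2]; [cite: Vanbaal2001]; [cite: GonzalezarroyoAltes1988]; [cite: MontvayMunster1994, (3.145)].
-/

set_option autoImplicit false

noncomputable section

open MeasureTheory
open scoped BigOperators ENNReal Quaternion
open Literature.MathematicalPhysics.QuantumFieldTheory hiding SU2 su2Quat_mul
open Literature.MathematicalPhysics.QuantumLattice
open Summit.QuantumFields.YangMills.Theorems.FemtoTransferGap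
open Summit.QuantumFields.YangMills.Theorems.FemtoTransferGap.TT
open Summit.QuantumFields.YangMills.Theorems.VirialFluxGap.RingDeficit
open Summit.QuantumFields.YangMills.Theorems.SwapTwistDeficit.ToronLog (haar_pi_nearlyCommuting_ge)

namespace Summit.QuantumFields.YangMills.Theorems.SwapTwistDeficit.PeriodicRingFloor

variable {L : ℕ} [NeZero L]

/-- ★★★ **LOGARITHMIC PERIODIC VOLUME FLOOR** at every fixed `L ≥ 1`: there are `c_L > 0` and `u₀ > 0` with
`c_L · u^{9L⁴−3/2} · log u⁻¹ ≤ (ringMeasure L).real {F₀ ≤ u}` for `0 < u ≤ u₀`. [cite: Luscher1983, §2] [cite: Vanbaal2001] [cite: GonzalezarroyoAltes1988] -/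
theorem log_volume_floor (L : ℕ) [NeZero L] :
    ∃ c : ℝ, 0 < c ∧ ∃ u₀ : ℝ, 0 < u₀ ∧ ∀ u : ℝ, 0 < u → u ≤ u₀ →
      c * u ^ (9 * (L : ℝ) ^ 4 - 3 / 2) * Real.log u⁻¹ ≤ (ringMeasure L).real {P | ringDeficit L (fun _ => false) P ≤ u} := by
  obtain ⟨c, hc, t₀, ht₀, hvol⟩ := haar_pi_nearlyCommuting_ge
  have hL : (0 : ℝ) < L := by exact_mod_cast NeZero.pos L
  have hK : (0 : ℝ) < 1500 * (L : ℝ) ^ 4 := by positivity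
  -- shrink `t₀` below `1`
  set t₁ : ℝ := min t₀ 1 with ht₁
  have ht₁0 : 0 < t₁ := lt_min ht₀ one_pos
  have ht₁1 : t₁ ≤ 1 := min_le_right _ _
  have hvol' : ∀ t : ℝ, 0 < t → t ≤ t₁ → c * t ^ 6 * Real.log t⁻¹ ≤
      (Measure.pi fun _ : Fin 4 => haarProbability SU2).real
        {C : Fin 4 → SU2 | ∀ k l : Fin 4, ‖su2Quat (C k) * su2Quat (C l) - su2Quat (C l) * su2Quat (C k)‖ ≤ t} :=
    fun t ht htt => hvol t ht (htt.trans (min_le_left _ _))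
  refine ⟨c / 2 * (1 / 34 : ℝ) ^ (6 * L ^ 4 - 3) * (1500 * (L : ℝ) ^ 4) ^ (-(9 * (L : ℝ) ^ 4 - 3 / 2)), by positivity,
    1500 * (L : ℝ) ^ 4 * t₁ ^ 2, by positivity, fun u hu0 hu => ?_⟩
  have h := log_volume_floor_of_fourLetterVolume (L := L) hc ht₁0 ht₁1 hvol' hu0 hu
  rw [Real.div_rpow hu0.le hK.le, div_eq_mul_inv (u ^ (9 * (L : ℝ) ^ 4 - 3 / 2)), ← Real.rpow_neg hK.le] at h
  calc c / 2 * (1 / 34 : ℝ) ^ (6 * L ^ 4 - 3) * (1500 * (L : ℝ) ^ 4) ^ (-(9 * (L : ℝ) ^ 4 - 3 / 2)) * u ^ (9 * (L : ℝ) ^ 4 - 3 / 2) *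
        Real.log u⁻¹
      = c / 2 * (1 / 34 : ℝ) ^ (6 * L ^ 4 - 3) * (u ^ (9 * (L : ℝ) ^ 4 - 3 / 2) * (1500 * (L : ℝ) ^ 4) ^ (-(9 * (L : ℝ) ^ 4 - 3 / 2))) *
        Real.log u⁻¹ := by ring
    _ ≤ _ := h

/-- ★★★ **LOGARITHMIC PERIODIC LAPLACE FLOOR** at every fixed `L ≥ 1`: there are `c_L > 0` and `β₀` with
`c_L · β^{−(9L⁴−3/2)} · log β ≤ ∫ e^{−βF₀} dμ_L` for `β ≥ β₀`. [cite: Luscher1983, §2] [cite: Vanbaal2001] -/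
theorem log_laplace_floor (L : ℕ) [NeZero L] :
    ∃ c : ℝ, 0 < c ∧ ∃ β₀ : ℝ, ∀ β : ℝ, β₀ ≤ β →
      c * β ^ (-(9 * (L : ℝ) ^ 4 - 3 / 2)) * Real.log β ≤ ∫ P, Real.exp (-(β * ringDeficit L (fun _ => false) P)) ∂(ringMeasure L) := by
  obtain ⟨c, hc, t₀, ht₀, hvol⟩ := haar_pi_nearlyCommuting_ge
  have hL : (0 : ℝ) < L := by exact_mod_cast NeZero.pos L
  have hK : (0 : ℝ) < 1500 * (L : ℝ) ^ 4 := by positivity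
  set t₁ : ℝ := min t₀ 1 with ht₁
  have ht₁0 : 0 < t₁ := lt_min ht₀ one_pos
  have ht₁1 : t₁ ≤ 1 := min_le_right _ _
  have hvol' : ∀ t : ℝ, 0 < t → t ≤ t₁ → c * t ^ 6 * Real.log t⁻¹ ≤
      (Measure.pi fun _ : Fin 4 => haarProbability SU2).real
        {C : Fin 4 → SU2 | ∀ k l : Fin 4, ‖su2Quat (C k) * su2Quat (C l) - su2Quat (C l) * su2Quat (C k)‖ ≤ t} :=
    fun t ht htt => hvol t ht (htt.trans (min_le_left _ _))
  refine ⟨Real.exp (-1) * (c / 2 * (1 / 34 : ℝ) ^ (6 * L ^ 4 - 3) * (1500 * (L : ℝ) ^ 4) ^ (-(9 * (L : ℝ) ^ 4 - 3 / 2))), by positivity,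
    max 1 (1500 * (L : ℝ) ^ 4 * t₁ ^ 2)⁻¹, fun β hβ => ?_⟩
  have hβ1 : 1 ≤ β := (le_max_left _ _).trans hβ
  have hβ0 : 0 < β := by linarith
  have h := log_laplace_floor_of_fourLetterVolume (L := L) hc ht₁0 ht₁1 hvol' hβ1 ((le_max_right _ _).trans hβ)
  rw [Real.mul_rpow hK.le hβ0.le] at h
  calc Real.exp (-1) * (c / 2 * (1 / 34 : ℝ) ^ (6 * L ^ 4 - 3) * (1500 * (L : ℝ) ^ 4) ^ (-(9 * (L : ℝ) ^ 4 - 3 / 2))) *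
        β ^ (-(9 * (L : ℝ) ^ 4 - 3 / 2)) * Real.log β
      = Real.exp (-1) * (c / 2 * (1 / 34 : ℝ) ^ (6 * L ^ 4 - 3) *
          ((1500 * (L : ℝ) ^ 4) ^ (-(9 * (L : ℝ) ^ 4 - 3 / 2)) * β ^ (-(9 * (L : ℝ) ^ 4 - 3 / 2))) * Real.log β) := by ring
    _ ≤ _ := h

/-- ★★★ **LOGARITHMIC PERIODIC FLOOR OF THE ZERO-FLUX THERMAL TRACE AT EVERY FIXED `L ≥ 1`**: there are `c_L > 0` and `β₀` with
`c_L · e^{12βL⁴} · β^{−(9L⁴−3/2)} · log β ≤ TT.physTrace L β (2L)` for `β ≥ β₀` — the real log-canonical threshold `9L⁴ − 3/2` of the periodic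
toron valley WITH its multiplicity-`2` logarithm, as a one-sided theorem (the ceiling of the same order is NOT proved here).
[cite: Luscher1983, §2] [cite: Vanbaal2001] [cite: MontvayMunster1994, (3.145)] -/
theorem log_physTrace_floor (L : ℕ) [NeZero L] :
    ∃ c : ℝ, 0 < c ∧ ∃ β₀ : ℝ, ∀ β : ℝ, β₀ ≤ β →
      c * Real.exp (12 * β * (L : ℝ) ^ 4) * β ^ (-(9 * (L : ℝ) ^ 4 - 3 / 2)) * Real.log β ≤ TT.physTrace L β (2 * L) := by
  obtain ⟨c, hc, t₀, ht₀, hvol⟩ := haar_pi_nearlyCommuting_ge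
  have hL : (0 : ℝ) < L := by exact_mod_cast NeZero.pos L
  have hK : (0 : ℝ) < 1500 * (L : ℝ) ^ 4 := by positivity
  set t₁ : ℝ := min t₀ 1 with ht₁
  have ht₁0 : 0 < t₁ := lt_min ht₀ one_pos
  have ht₁1 : t₁ ≤ 1 := min_le_right _ _
  have hvol' : ∀ t : ℝ, 0 < t → t ≤ t₁ → c * t ^ 6 * Real.log t⁻¹ ≤
      (Measure.pi fun _ : Fin 4 => haarProbability SU2).real
        {C : Fin 4 → SU2 | ∀ k l : Fin 4, ‖su2Quat (C k) * su2Quat (C l) - su2Quat (C l) * su2Quat (C k)‖ ≤ t} :=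
    fun t ht htt => hvol t ht (htt.trans (min_le_left _ _))
  refine ⟨(1 / 8 : ℝ) * (Real.exp (-1) * (c / 2 * (1 / 34 : ℝ) ^ (6 * L ^ 4 - 3) * (1500 * (L : ℝ) ^ 4) ^ (-(9 * (L : ℝ) ^ 4 - 3 / 2)))),
    by positivity, max 1 (1500 * (L : ℝ) ^ 4 * t₁ ^ 2)⁻¹, fun β hβ => ?_⟩
  have hβ1 : 1 ≤ β := (le_max_left _ _).trans hβ
  have hβ0 : 0 < β := by linarith
  have h := log_physTrace_floor_of_fourLetterVolume (L := L) hc ht₁0 ht₁1 hvol' hβ1 ((le_max_right _ _).trans hβ)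
  rw [Real.mul_rpow hK.le hβ0.le] at h
  calc (1 / 8 : ℝ) * (Real.exp (-1) * (c / 2 * (1 / 34 : ℝ) ^ (6 * L ^ 4 - 3) * (1500 * (L : ℝ) ^ 4) ^ (-(9 * (L : ℝ) ^ 4 - 3 / 2)))) *
        Real.exp (12 * β * (L : ℝ) ^ 4) * β ^ (-(9 * (L : ℝ) ^ 4 - 3 / 2)) * Real.log β
      = (1 / 8 : ℝ) * Real.exp (12 * β * (L : ℝ) ^ 4) * (Real.exp (-1) * (c / 2 * (1 / 34 : ℝ) ^ (6 * L ^ 4 - 3) *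
          ((1500 * (L : ℝ) ^ 4) ^ (-(9 * (L : ℝ) ^ 4 - 3 / 2)) * β ^ (-(9 * (L : ℝ) ^ 4 - 3 / 2))) * Real.log β)) := by ring
    _ ≤ _ := h

end Summit.QuantumFields.YangMills.Theorems.SwapTwistDeficit.PeriodicRingFloor

end
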